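import Mathlib.Data.Nat.Choose.Bounds
import Literature.Computability.AlgebraicComplexity.AsymptoticSumInequality
import Literature.Computability.AlgebraicComplexity.BorderRankKronecker
import HarnessLib

/-!
# Schönhage's `τ`-theorem for the border rank (Bläser 2013, Thm. 7.5) — `Blaser2013_thm75` proved

Topic `Literature/Computability/AlgebraicComplexity`. `SchoenhageTau.lean` vendors Schönhage's
`τ`-theorem (asymptotic sum inequality) in Bläser's border-rank form as the named fact

> `Blaser2013_thm75`: if `R̲(⊕_{i=1}^p ⟨kᵢ, mᵢ, nᵢ⟩) ≤ r` with `r > p`, then `ω ≤ 3τ` where `τ` is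
> defined by `∑_{i=1}^p (kᵢ mᵢ nᵢ)^τ = r`

(over every field `K : Type u`; `R̲ = algBorderRank`, the border rank over `K[ε]` of Def. 6.1, and
`⊕ᵢ ⟨kᵢ,mᵢ,nᵢ⟩ = matMulDirectSum K k m n`). `AsymptoticSumInequality.lean` proves the RANK version
(`asymptoticSumInequality_rank : R(⊕ᵢ ⟨kᵢ,mᵢ,nᵢ⟩) ≤ r → ∑ᵢ (kᵢmᵢnᵢ)^{ω/3} ≤ r`). This file proves
the border-rank version and the DISCHARGE `Blaser2013_thm75_holds : Blaser2013_thm75`: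

* `le_of_forall_pow_le_polynomial_mul_pow` — if `Sᴺ ≤ C (N+1)ᵈ rᴺ` for all `N` then `S ≤ r` (polynomial factors are
  invisible in the `N`-th root limit; the "since `ω` is an infimum" step).
* `tensorRank_matMulDirectSum_words_le` — the direct sum over all words `w ∈ [p]^N` of the blocks
  `⟨∏ⱼ k_{wⱼ}, ∏ⱼ m_{wⱼ}, ∏ⱼ n_{wⱼ}⟩` is a restriction of `D^{⊗N}`, `D = ⊕ᵢ ⟨kᵢ,mᵢ,nᵢ⟩` (Bläser:
  "`D^{⊗s} = ⊕_σ (s!/σ₁!⋯σ_p!) ⊙ ⟨∏ kᵢ^{σᵢ}, …⟩`", here before grouping the words by type);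
  `sum_words_rpow` — `∑_w (∏ⱼ k_{wⱼ} m_{wⱼ} n_{wⱼ})ˣ = (∑ᵢ (kᵢmᵢnᵢ)ˣ)ᴺ`.
* `asymptoticSumInequality_algBorderRank` — **`R̲(⊕ᵢ ⟨kᵢ,mᵢ,nᵢ⟩) ≤ r → ∑ᵢ (kᵢmᵢnᵢ)^{ω/3} ≤ r`**.
* `Blaser2013_thm75_holds` — the printed `τ`-form, via `omega_le_three_mul_of_sum_rpow_omega_le`.

## Proof (Bläser 2013, pp. 32–34, with the rank version as the last step)

As in print: there is an `h` with `R_h(D) ≤ r` (Def. 6.1(2); `exists_algBorderRank_eq_approxRank`,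
`SchoenhageTauBini.lean`); by Thm. 6.3(3), `R_{Nh}(D^{⊗N}) ≤ rᴺ`, and by Lemma 6.4,
`R(D^{⊗N}) ≤ c_{Nh} rᴺ` with `c_{Nh} = C(Nh+2, 2)` polynomial in `N`
(`tensorRank_kroneckerPow_le_of_approxRank_le`, `BorderRankKronecker.lean`, built on
`SchoenhageTauBini.lean` and `SchoenhageTauProofs.lean`). `D^{⊗N}` contains (as a restriction,
indeed it is isomorphic to) the direct sum of the `pᴺ` matrix tensors
`⟨∏ⱼ k_{wⱼ}, ∏ⱼ m_{wⱼ}, ∏ⱼ n_{wⱼ}⟩`, `w ∈ [p]^N`, whose rank is therefore `≤ C(Nh+2,2) rᴺ`. Where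
the printed proof now fixes the type class maximising `(*)` and applies Lemma 7.7, we apply the
already proved rank version of the theorem (`asymptoticSumInequality_rank`, whose proof is exactly
that argument) to this direct sum:
`(∑ᵢ (kᵢmᵢnᵢ)^{ω/3})ᴺ = ∑_w (∏ⱼ k_{wⱼ}m_{wⱼ}n_{wⱼ})^{ω/3} ≤ C(Nh+2,2) rᴺ ≤ (h+2)²(N+1)² rᴺ` for
every `N`, whence `∑ᵢ (kᵢmᵢnᵢ)^{ω/3} ≤ r` (`le_of_forall_pow_le_polynomial_mul_pow`), which for `r > p` is equivalent
to the printed conclusion `ω ≤ 3τ`, `∑ᵢ (kᵢmᵢnᵢ)^τ = r`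
(`omega_le_three_mul_of_sum_rpow_omega_le`).

## References

* M. Bläser, *Fast Matrix Multiplication*, Theory of Computing Library, Graduate Surveys 5 (2013),
  1–60, doi:10.4086/toc.gs.2013.005 (held: `paper:doi-10-4086-toc-gs-2013-005`, read pp. 26–28,
  31–34): Def. 6.1, Thm. 6.3, Lemma 6.4, Thm. 7.5 and its proof (pp. 32–34). [Blaser2013]
* A. Schönhage, *Partial and total matrix multiplication*, SIAM J. Comput. 10 (1981) 434–455
  (original; cited through Bläser 2013, [28]).
-/

noncomputable section

open scoped BigOperators
open Filter Topology

namespace Literature.Computability.AlgebraicComplexity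

universe u

/-! ## A limiting lemma -/

section Limit

/-- **Polynomial factors are invisible to `N`-th roots**: if `Sᴺ ≤ C · (N+1)ᵈ · rᴺ` for all `N`
(`r ≥ 0`), then `S ≤ r` — otherwise `a = S/r > 1` and `aᴺ ≤ C (N+1)ᵈ` contradicts
`(N+1)ᵈ / a^{N+1} → 0` (the step "since `ω` is an infimum, `s → ∞`" of Bläser 2013, proofs of
Thm. 6.6, Lemma 7.7 and Thm. 7.5). [folklore] -/
theorem le_of_forall_pow_le_polynomial_mul_pow (S r C : ℝ) (d : ℕ) (hr : 0 ≤ r)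
    (h : ∀ N : ℕ, S ^ N ≤ C * ((N : ℝ) + 1) ^ d * r ^ N) : S ≤ r := by
  by_contra hlt
  rw [not_le] at hlt
  have hC : 0 < C := by
    have h0 := h 0
    simp only [pow_zero, Nat.cast_zero, zero_add, one_pow, mul_one] at h0
    linarith
  rcases hr.eq_or_lt with hr0 | hr0
  · -- `r = 0`: `S ^ 1 ≤ 0`
    have h1 := h 1
    rw [← hr0] at h1
    simp only [pow_one, zero_pow one_ne_zero, mul_zero] at h1
    linarith
  · set a : ℝ := S / r with ha
    have ha1 : 1 < a := (one_lt_div hr0).2 hlt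
    have ha0 : 0 < a := one_pos.trans ha1
    have hSa : S = a * r := by rw [ha, div_mul_cancel₀ _ hr0.ne']
    -- `a^N ≤ C (N+1)^d`
    have hpow : ∀ N : ℕ, a ^ N ≤ C * ((N : ℝ) + 1) ^ d := by
      intro N
      have h1 := h N
      rw [hSa, mul_pow] at h1
      exact le_of_mul_le_mul_right (by linarith) (pow_pos hr0 N)
    -- but `(N+1)^d / a^(N+1) → 0`
    have hlim : Tendsto (fun N : ℕ => (((N + 1 : ℕ) : ℝ)) ^ d / a ^ (N + 1)) atTop (𝓝 0) :=
      (tendsto_pow_const_div_const_pow_of_one_lt d ha1).comp (tendsto_add_atTop_nat 1)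
    have hsmall : (0 : ℝ) < 1 / (C * a) := by positivity
    obtain ⟨N, hN⟩ := (hlim.eventually (gt_mem_nhds hsmall)).exists
    rw [div_lt_div_iff₀ (by positivity) (by positivity), one_mul, pow_succ] at hN
    have h2 := mul_le_mul_of_nonneg_right (hpow N) ha0.le
    push_cast at hN
    nlinarith [h2, hN]

end Limit

/-! ## `D^{⊗N}` and the direct sum over words -/

section Words

variable (K : Type u) [CommSemiring K] {p : ℕ} (k m n : Fin p → ℕ) (N : ℕ)

/-- **The direct sum over words is a restriction of the tensor power.** For `D = ⊕ᵢ ⟨kᵢ,mᵢ,nᵢ⟩`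
and words `w ∈ [p]^N ≅ [pᴺ]` (`finFunctionFinEquiv`), the direct sum
`⊕_w ⟨∏ⱼ k_{wⱼ}, ∏ⱼ m_{wⱼ}, ∏ⱼ n_{wⱼ}⟩` is the restriction of `D^{⊗N}` along the index maps
(word `w`, matrix index `κ < ∏ⱼ k_{wⱼ}`, …) ↦ (`j ↦ ⟨wⱼ, (digit j of κ, …)⟩`) for any bijections
`Fin (∏ⱼ k_{wⱼ}) ≃ ∏ⱼ Fin k_{wⱼ}`; hence its rank is at most `R(D^{⊗N})` (Bläser 2013, proof of
Thm. 7.5: "by taking tensor powers and using the fact that the tensors form a ring,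
`D^{⊗s} = ⊕_σ (s!/σ₁!⋯σ_p!) ⊙ ⟨∏ kᵢ^{σᵢ}, ∏ mᵢ^{σᵢ}, ∏ nᵢ^{σᵢ}⟩`", before grouping words by type).
[cite: Blaser2013, Thm. 7.5 (proof)] -/
theorem tensorRank_matMulDirectSum_words_le :
    tensorRank (matMulDirectSum K
        (fun w : Fin (p ^ N) => ∏ j, k (finFunctionFinEquiv.symm w j))
        (fun w => ∏ j, m (finFunctionFinEquiv.symm w j))
        (fun w => ∏ j, n (finFunctionFinEquiv.symm w j))) ≤
      tensorRank (kroneckerPow (matMulDirectSum K k m n) N) := by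
  classical
  have hinj : Function.Injective
      (fun w : Fin (p ^ N) => (finFunctionFinEquiv.symm w : Fin N → Fin p)) :=
    finFunctionFinEquiv.symm.injective
  -- bijections `Fin (∏ⱼ k_{wⱼ}) ≃ ∏ⱼ Fin k_{wⱼ}` etc. from the cardinalities
  obtain ⟨eK, -⟩ : ∃ _e : ∀ w : Fin (p ^ N), Fin (∏ j, k (finFunctionFinEquiv.symm w j)) ≃
      (∀ j : Fin N, Fin (k (finFunctionFinEquiv.symm w j))), True :=
    ⟨fun w => (Fintype.equivFinOfCardEq ((Fintype.card_pi
      (α := fun j => Fin (k (finFunctionFinEquiv.symm w j)))).trans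
      (by simp only [Fintype.card_fin]))).symm, trivial⟩
  obtain ⟨eM, -⟩ : ∃ _e : ∀ w : Fin (p ^ N), Fin (∏ j, m (finFunctionFinEquiv.symm w j)) ≃
      (∀ j : Fin N, Fin (m (finFunctionFinEquiv.symm w j))), True :=
    ⟨fun w => (Fintype.equivFinOfCardEq ((Fintype.card_pi
      (α := fun j => Fin (m (finFunctionFinEquiv.symm w j)))).trans
      (by simp only [Fintype.card_fin]))).symm, trivial⟩
  obtain ⟨eN, -⟩ : ∃ _e : ∀ w : Fin (p ^ N), Fin (∏ j, n (finFunctionFinEquiv.symm w j)) ≃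
      (∀ j : Fin N, Fin (n (finFunctionFinEquiv.symm w j))), True :=
    ⟨fun w => (Fintype.equivFinOfCardEq ((Fintype.card_pi
      (α := fun j => Fin (n (finFunctionFinEquiv.symm w j)))).trans
      (by simp only [Fintype.card_fin]))).symm, trivial⟩
  have key : matMulDirectSum K
        (fun w : Fin (p ^ N) => ∏ j, k (finFunctionFinEquiv.symm w j))
        (fun w => ∏ j, m (finFunctionFinEquiv.symm w j))
        (fun w => ∏ j, n (finFunctionFinEquiv.symm w j)) = fun a b c =>
      kroneckerPow (matMulDirectSum K k m n) N
        (fun j => ⟨finFunctionFinEquiv.symm a.1 j, (eK a.1 a.2.1 j, eN a.1 a.2.2 j)⟩)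
        (fun j => ⟨finFunctionFinEquiv.symm b.1 j, (eK b.1 b.2.1 j, eM b.1 b.2.2 j)⟩)
        (fun j => ⟨finFunctionFinEquiv.symm c.1 j, (eM c.1 c.2.1 j, eN c.1 c.2.2 j)⟩) := by
    funext a b c
    obtain ⟨w₁, κ, ν⟩ := a
    obtain ⟨w₂, κ', μ'⟩ := b
    obtain ⟨w₃, μ'', ν''⟩ := c
    simp only [matMulDirectSum, kroneckerPow_apply]
    rw [Fintype.prod_boole]
    refine ite_congr_prop ?_
    constructor
    · rintro ⟨h12, h23, hκ, hμ, hν⟩ j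
      subst h12
      subst h23
      obtain rfl : κ = κ' := Fin.ext hκ
      obtain rfl : μ' = μ'' := Fin.ext hμ
      obtain rfl : ν = ν'' := Fin.ext hν
      exact ⟨rfl, rfl, rfl, rfl, rfl⟩
    · intro H
      have h12 : w₁ = w₂ := hinj (funext fun j => (H j).1)
      subst h12
      have h13 : w₁ = w₃ := hinj (funext fun j => (H j).2.1)
      subst h13
      refine ⟨rfl, rfl, ?_, ?_, ?_⟩
      · rw [(eK w₁).injective (funext fun j => Fin.ext (H j).2.2.1)]
      · rw [(eM w₁).injective (funext fun j => Fin.ext (H j).2.2.2.1)]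
      · rw [(eN w₁).injective (funext fun j => Fin.ext (H j).2.2.2.2)]
  rw [key]
  exact tensorRank_precomp_le _ _ _ _

/-- **Expanding the `N`-th power over words**:
`∑_{w ∈ [p]^N} (∏ⱼ k_{wⱼ} · ∏ⱼ m_{wⱼ} · ∏ⱼ n_{wⱼ})ˣ = (∑ᵢ (kᵢ mᵢ nᵢ)ˣ)ᴺ` (Bläser 2013, proof of
Thm. 7.5: "by raising the defining equation for `τ` to the `s`-th power").
[cite: Blaser2013, Thm. 7.5 (proof)] -/
theorem sum_words_rpow (x : ℝ) :
    ∑ w : Fin (p ^ N), (((∏ j, k (finFunctionFinEquiv.symm w j)) *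
        (∏ j, m (finFunctionFinEquiv.symm w j)) *
        (∏ j, n (finFunctionFinEquiv.symm w j)) : ℕ) : ℝ) ^ x =
      (∑ i, ((k i * m i * n i : ℕ) : ℝ) ^ x) ^ N := by
  rw [Fintype.sum_pow]
  refine Fintype.sum_equiv finFunctionFinEquiv.symm _
    (fun τ : Fin N → Fin p => ∏ j, ((k (τ j) * m (τ j) * n (τ j) : ℕ) : ℝ) ^ x) fun w => ?_
  rw [Real.finsetProd_rpow _ _ (fun i _ => by positivity)]
  congr 1
  push_cast
  rw [Finset.prod_mul_distrib, Finset.prod_mul_distrib]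

end Words

/-! ## The asymptotic sum inequality for the border rank -/

section ASI

variable (K : Type u) [Field K] {p : ℕ} (k m n : Fin p → ℕ)

/-- **Schönhage's asymptotic sum inequality, border rank version** (Bläser 2013, Thm. 7.5 in the
form `∑ᵢ (kᵢmᵢnᵢ)^{ω/3} ≤ r`; Schönhage 1981; Bürgisser–Clausen–Shokrollahi 1997, (15.11)): if
`R̲(⊕_{i=1}^p ⟨kᵢ, mᵢ, nᵢ⟩) ≤ r` then `∑ᵢ (kᵢ mᵢ nᵢ)^{ω/3} ≤ r`. Proof: `R(D^{⊗N}) ≤ C(Nh+2,2) rᴺ`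
(Thm. 6.3(3) + Lemma 6.4, `tensorRank_kroneckerPow_le_of_approxRank_le`), the direct sum over
words is a restriction of `D^{⊗N}`, and the rank version applied to it gives
`(∑ᵢ (kᵢmᵢnᵢ)^{ω/3})ᴺ ≤ C(Nh+2,2) rᴺ ≤ (h+2)²(N+1)² rᴺ`; then `N → ∞`.
[cite: Blaser2013, Thm. 7.5] -/
theorem asymptoticSumInequality_algBorderRank {r : ℕ}
    (h : algBorderRank (matMulDirectSum K k m n) ≤ r) :
    ∑ i, ((k i * m i * n i : ℕ) : ℝ) ^ (omega K / 3) ≤ r := by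
  classical
  -- `R̲(D) = R_{h₀}(D) ≤ r` for some `h₀`, hence `R(D^{⊗N}) ≤ C(N h₀ + 2, 2) r^N` for all `N`
  obtain ⟨h₀, hh⟩ := exists_algBorderRank_eq_approxRank (matMulDirectSum K k m n)
  have hh' : approxRank h₀ (matMulDirectSum K k m n) ≤ r := by rw [← hh]; exact h
  refine le_of_forall_pow_le_polynomial_mul_pow _ _ (((h₀ : ℝ) + 2) ^ 2) 2 (Nat.cast_nonneg r)
    fun N => ?_
  -- the rank version for the direct sum over words, `R(⊕_w …) ≤ R(D^{⊗N}) ≤ C(N h₀ + 2, 2) r^N`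
  have hW := asymptoticSumInequality_rank K
    (fun w : Fin (p ^ N) => ∏ j, k (finFunctionFinEquiv.symm w j))
    (fun w => ∏ j, m (finFunctionFinEquiv.symm w j))
    (fun w => ∏ j, n (finFunctionFinEquiv.symm w j))
    ((tensorRank_matMulDirectSum_words_le K k m n N).trans
      (tensorRank_kroneckerPow_le_of_approxRank_le hh' N))
  rw [sum_words_rpow k m n N, Nat.cast_mul, Nat.cast_pow] at hW
  refine hW.trans (mul_le_mul_of_nonneg_right ?_ (by positivity))
  -- `C(N h₀ + 2, 2) ≤ (N h₀ + 2)² ≤ ((h₀ + 2)(N + 1))²`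
  have hc : Nat.choose (N * h₀ + 2) 2 ≤ (h₀ + 2) ^ 2 * (N + 1) ^ 2 :=
    calc Nat.choose (N * h₀ + 2) 2 ≤ (N * h₀ + 2) ^ 2 := Nat.choose_le_pow _ _
      _ ≤ ((h₀ + 2) * (N + 1)) ^ 2 := Nat.pow_le_pow_left (by nlinarith) 2
      _ = (h₀ + 2) ^ 2 * (N + 1) ^ 2 := by ring
  calc ((Nat.choose (N * h₀ + 2) 2 : ℕ) : ℝ) ≤ (((h₀ + 2) ^ 2 * (N + 1) ^ 2 : ℕ) : ℝ) := by
        exact_mod_cast hc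
    _ = ((h₀ : ℝ) + 2) ^ 2 * ((N : ℝ) + 1) ^ 2 := by push_cast; ring

/-- DISCHARGE of the named fact `Blaser2013_thm75` (`SchoenhageTau.lean`) — **Bläser 2013,
Theorem 7.5, Schönhage's `τ`-theorem**: over every field, if `R̲(⊕_{i=1}^p ⟨kᵢ, mᵢ, nᵢ⟩) ≤ r` with
`r > p`, then `ω ≤ 3τ` for every `τ` with `∑_{i=1}^p (kᵢ mᵢ nᵢ)^τ = r`. From
`asymptoticSumInequality_algBorderRank` (`∑ (kᵢmᵢnᵢ)^{ω/3} ≤ r = ∑ (kᵢmᵢnᵢ)^τ`) and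
`omega_le_three_mul_of_sum_rpow_omega_le` (`r > p` forces some `kᵢmᵢnᵢ ≥ 2`, where
`x ↦ (kᵢmᵢnᵢ)^x` is strictly increasing). [cite: Blaser2013, Thm. 7.5] -/
theorem Blaser2013_thm75_holds : Blaser2013_thm75 :=
  fun K _ _p k m n _r hpr hR _τ hτ =>
    omega_le_three_mul_of_sum_rpow_omega_le K k m n hpr
      (asymptoticSumInequality_algBorderRank K k m n hR) hτ

end ASI

end Literature.Computability.AlgebraicComplexity

end
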